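import Literature.NumberTheory.Automorphic.ResGLnConeDictionaryCone
import Literature.Algebra.Lie.ChevalleyEilenbergCasimirHomotopy
import Summits.Langlands.Langlands.Theorems.IrreducibilityBySelfDualityHeckeEigenvalueFieldResConeAnalytic
import HarnessLib

/-!
# Crux `HeckeEigenvalueField` (stmt-Langlands-13632), line `Sketch` — stub BASIC: the cone form of a
# basic cocycle is a basic form on the positive cone

Namespace `Summit.Langlands.Langlands.Theorems.HeckeEigenvalueField.Res`.  Theorems only.

For `π = W / W'` automorphic on `GL_n(𝔸_K)`, the coefficients `E = E_λ(ℂ) ⊗ ε_S`, a COCYCLE `η` of the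
`(𝔤, K_∞)`-complex `ConeDictionary.gkComplexLS π S λ` in degree `q + 1` with `i_Z η = 0` for the central
`Z = 1 ∈ 𝔤 = 𝔤𝔩_n(K_∞)`, and a finite-adelic `c` (vocabulary of
`Literature/…/ResGLnConeDictionary{,Cone}`):

* `lie_one_apply_eq_zero_of_basic` — `Z` kills every VALUE of `η`: Cartan's formula
  `θ_Z = i_Z d + d i_Z` gives `θ_Z η = 0`, and `θ_Z η = ρ(Z) ∘ η` since `Z` is central;
* `leftForm_smul_eq_of_basic` — **the left form is invariant under positive scalings of the point**:
  `E(s g) η(Y)(s g, c) = E(g) η(Y)(g, c)` for `s > 0` (the curve `s ↦ E(s g) η(Y)(s g, c)` on `(0, ∞)` has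
  derivative `s⁻¹ E(s g) (Z · η(Y))(s g, c) = 0`, `stub_fderiv_twistedEval`);
* `stub_coneForm_basic` — **the registered stub**: (a) `ω_c(H)(H, …) = 0` (the Euler vector `H = g gᴴ`
  is read as `g⁻¹ · ½ H g⁻ᴴ = ½ · 1 = ½ Z` in the first slot of `η`, killed by `i_Z η = 0`), and
  (b) `ω_c(r H) ∘ ∧(r ·) = ω_c(H)` for `r > 0` (`√r g` is a square root of `r H`, independence of the
  section `ConeDictionary.coneForm_eq_of_mul_conjTranspose_eq`, the slots of `η` are unchanged and the
  point moves from `g` to `√r g`).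

## References

* A. Borel, N. Wallach, *Continuous cohomology, discrete subgroups, and representations of reductive
  groups*, 2nd ed. (2000), I §1.3, I §5.1, VII 2.2. [BorelWallach2000]
* C. Chevalley, S. Eilenberg, Trans. AMS 63 (1948), §23. [ChevalleyEilenberg1948]
-/

set_option linter.dupNamespace false -- project-wide: `Summit.Langlands.Langlands` is the mandated namespace

noncomputable section

open scoped Matrix.Norms.Operator ContDiff Topology TensorProduct Classical Matrix
open Filter NumberField NumberField.mixedEmbedding
open Literature.NumberTheory.Automorphic Literature.NumberTheory.Automorphic.RealMatrixGroup
  Literature.NumberTheory.Automorphic.ConeDictionary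
open Literature.Algebra.Lie Literature.Algebra.Lie.ChevalleyEilenberg

namespace Summit.Langlands.Langlands.Theorems.HeckeEigenvalueField.Res

variable {n : ℕ} {K : Type} [Field K] [NumberField K] {hcpt : isCompact_glFiniteIntegralLevel n K}
  (π : AutomorphicRepData (AutomorphyDatum.gl n K hcpt))
  (S : Finset {w : InfinitePlace K // w.IsReal}) (lam : (K →+* ℂ) → Fin n → ℤ) {q : ℕ}

/-! ### A central element basic for a cocycle kills its values -/

set_option maxHeartbeats 800000 in
-- abbrev towers over the datum (as in `ResGLnConeDictionary`)
/-- **A central element basic for a cocycle kills its values**: if `η` is a cocycle of the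
`(𝔤, K_∞)`-complex and `i_Z η = 0` for the central `Z = 1 ∈ 𝔤𝔩_n(K_∞)`, then `Z` acts by `0` on every
value of `η` (Cartan: `θ_Z η = i_Z dη + d i_Z η = 0`, and `θ_Z = ρ(Z) ∘ ·` for central `Z`).
[cite: BorelWallach2000, I §1.3] [cite: ChevalleyEilenberg1948, §23] -/
theorem lie_one_apply_eq_zero_of_basic {η : ConeDictionary.Cochain π lam (q + 1)}
    (hη : η ∈ (ConeDictionary.gkComplexLS π S lam).cocycles (q + 1))
    (hZ : ins q (⟨1, trivial⟩ : (AutomorphyDatum.gl n K hcpt).arch.lie) η = 0)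
    (v : Fin (q + 1) → (AutomorphyDatum.gl n K hcpt).arch.lie) :
    ⁅(⟨1, trivial⟩ : (AutomorphyDatum.gl n K hcpt).arch.lie), η v⁆ = 0 := by
  set Z : (AutomorphyDatum.gl n K hcpt).arch.lie := ⟨1, trivial⟩
  have hcentral : ∀ x : (AutomorphyDatum.gl n K hcpt).arch.lie, ⁅Z, x⁆ = 0 := by
    intro x
    rw [Subtype.ext_iff]
    -- the bracket of the Lie subalgebra is the commutator of matrices (no instance search on `M_n(K_∞)`)
    change (1 : Matrix (Fin n) (Fin n) (mixedSpace K)) * (x : Matrix (Fin n) (Fin n) (mixedSpace K)) -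
      (x : Matrix (Fin n) (Fin n) (mixedSpace K)) * 1 = 0
    rw [Matrix.one_mul, Matrix.mul_one, sub_self]
  have hd : d ℝ (AutomorphyDatum.gl n K hcpt).arch.lie (ConeDictionary.Carrier π lam) (q + 1) η = 0 :=
    ((Subcomplex.mem_cocycles_iff _ (q + 1) η).1 hη).2
  -- Cartan: `i_Z dη = θ_Z η - d i_Z η`, so `θ_Z η = 0`
  have hθ : lieDer ℝ (AutomorphyDatum.gl n K hcpt).arch.lie (ConeDictionary.Carrier π lam) (q + 1) Z η = 0 := by
    have hcartan := ins_d_succ (R := ℝ) (L := (AutomorphyDatum.gl n K hcpt).arch.lie)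
      (M := ConeDictionary.Carrier π lam) q Z η
    have h1 : ins (q + 1) Z (d ℝ (AutomorphyDatum.gl n K hcpt).arch.lie (ConeDictionary.Carrier π lam) (q + 1) η) = 0 := by
      rw [hd]; exact map_zero _
    have h2 : d ℝ (AutomorphyDatum.gl n K hcpt).arch.lie (ConeDictionary.Carrier π lam) q (ins q Z η) = 0 := by
      rw [hZ]; exact map_zero _
    rw [h1, h2, sub_zero] at hcartan
    exact hcartan.symm
  -- `θ_Z η = ρ(Z) ∘ η` for central `Z`
  have hpost := lieDer_eq_post_toEnd_of_central (R := ℝ) (M := ConeDictionary.Carrier π lam) hcentral (q + 1) η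
  rw [hθ] at hpost
  have := congrArg (fun f : ConeDictionary.Cochain π lam (q + 1) => f v) hpost
  rw [post_apply, LieModule.toEnd_apply_apply] at this
  rw [← this]
  rfl

/-! ### The left form is invariant under positive scalings of the point -/

set_option maxHeartbeats 800000 in
-- abbrev towers over the datum; one curve, one constancy argument
/-- **Scale invariance of the left form of a basic cocycle**: for `g` invertible and `s > 0`,
`E(s g) η(Y)(s g, c) = E(g) η(Y)(g, c)`.  The curve `φ(s) = E(s g) η(Y)(s g, c)` on `(0, ∞)` has
derivative `Dφ(s) = D F(s g)(g) = s⁻¹ D F(s g)((s g) · 1) = s⁻¹ E(s g) (Z · η(Y))(s g, c)`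
(`stub_fderiv_twistedEval` for the fixed tensor `η(Y)`), which vanishes because the central `Z = 1` kills
the values of `η` (`lie_one_apply_eq_zero_of_basic`); a function with zero derivative on the connected
open `(0, ∞)` is constant. [cite: BorelWallach2000, I §1.3 and VII 2.2] -/
theorem leftForm_smul_eq_of_basic {η : ConeDictionary.Cochain π lam (q + 1)}
    (hη : η ∈ (ConeDictionary.gkComplexLS π S lam).cocycles (q + 1))
    (hZ : ins q (⟨1, trivial⟩ : (AutomorphyDatum.gl n K hcpt).arch.lie) η = 0)
    (c : BigHeckeGLn.FiniteAdelicGL n K) {g : Matrix (Fin n) (Fin n) (mixedSpace K)} (hg : IsUnit g)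
    {s : ℝ} (hs : 0 < s) (Y : Fin (q + 1) → Matrix (Fin n) (Fin n) (mixedSpace K)) :
    leftForm π S lam η c (s • g) Y = leftForm π S lam η c g Y := by
  -- the fixed tensor `t = η(Y)` and its twisted evaluation `F`
  set t : π.W ⊗[ℂ] ResGLnCohomology.CoeffModule ℂ n K lam :=
    @id (π.W ⊗[ℂ] ResGLnCohomology.CoeffModule ℂ n K lam) (η fun i => toLie n K hcpt (Y i)) with ht
  set F : Matrix (Fin n) (Fin n) (mixedSpace K) → ResGLnCohomology.CoeffModule ℂ n K lam :=
    fun m => σS hcpt S lam (GLn.archOfMatrix n K m)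
      (π.evalTensor (ResGLnCohomology.CoeffModule ℂ n K lam) t (adelicPt hcpt (GLn.archOfMatrix n K m) c))
    with hF
  -- `Z` kills the value `η(Y)`
  have hZt : GKTensor.lie (AutomorphyDatum.gl n K hcpt).arch π.lieRepW (σ𝔤S hcpt lam)
      (⟨1, trivial⟩ : (AutomorphyDatum.gl n K hcpt).arch.lie) t = 0 :=
    lie_one_apply_eq_zero_of_basic π S lam hη hZ fun i => toLie n K hcpt (Y i)
  -- the derivative of `F` at an invertible `m₀` along `m₀ = m₀ · Z` vanishes
  have hderiv0 : ∀ {m₀ : Matrix (Fin n) (Fin n) (mixedSpace K)}, IsUnit m₀ → fderiv ℝ F m₀ m₀ = 0 := by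
    intro m₀ hm₀
    have h : fderiv ℝ F m₀ (m₀ * 1) = σS hcpt S lam (GLn.archOfMatrix n K m₀)
        (π.evalTensor (ResGLnCohomology.CoeffModule ℂ n K lam)
          (GKTensor.lie (AutomorphyDatum.gl n K hcpt).arch π.lieRepW (σ𝔤S hcpt lam)
            (⟨1, trivial⟩ : (AutomorphyDatum.gl n K hcpt).arch.lie) t)
          (adelicPt hcpt (GLn.archOfMatrix n K m₀) c)) :=
      (stub_fderiv_twistedEval hcpt π S lam t c hm₀).2 ⟨1, trivial⟩
    rw [Matrix.mul_one] at h
    rw [h, hZt, map_zero, Pi.zero_apply, map_zero]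
  -- scalings of `g` are invertible
  have hsmul : ∀ {s : ℝ}, 0 < s → IsUnit (s • g) := by
    intro s hs
    rw [Algebra.smul_def]
    exact ((isUnit_iff_ne_zero.2 hs.ne').map (algebraMap ℝ (Matrix (Fin n) (Fin n) (mixedSpace K)))).mul hg
  -- the curve `s ↦ F (s • g)` has zero derivative on `(0, ∞)`
  have hcurve : ∀ s : ℝ, 0 < s → HasDerivAt (fun s : ℝ => F (s • g)) 0 s := by
    intro s hs
    have hsu : IsUnit (s • g) := hsmul hs
    have h1 : HasDerivAt (fun s : ℝ => s • g) g s := by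
      have h := (hasDerivAt_id' s).smul_const g
      rwa [one_smul] at h
    have h2 : HasFDerivAt F (fderiv ℝ F (s • g)) (s • g) :=
      ((stub_fderiv_twistedEval hcpt π S lam t c hsu).1.differentiableAt (by simp)).hasFDerivAt
    have h3 : HasDerivAt (F ∘ fun s : ℝ => s • g) (fderiv ℝ F (s • g) g) s := h2.comp_hasDerivAt s h1
    have hval : fderiv ℝ F (s • g) g = 0 :=
      calc fderiv ℝ F (s • g) g = fderiv ℝ F (s • g) (s⁻¹ • (s • g)) := by
            rw [smul_smul, inv_mul_cancel₀ hs.ne', one_smul]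
        _ = s⁻¹ • fderiv ℝ F (s • g) (s • g) := map_smul _ _ _
        _ = 0 := by rw [hderiv0 hsu, smul_zero]
    rw [hval] at h3
    exact h3
  have hconst : F (s • g) = F ((1 : ℝ) • g) :=
    IsOpen.is_const_of_deriv_eq_zero (f := fun s : ℝ => F (s • g)) isOpen_Ioi isPreconnected_Ioi
      (fun x hx => (hcurve x hx).differentiableAt.differentiableWithinAt)
      (fun x hx => (hcurve x hx).deriv) (Set.mem_Ioi.2 hs) (Set.mem_Ioi.2 one_pos)
  rw [one_smul] at hconst
  exact hconst

/-! ### The two halves of the stub, on vectors -/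

set_option maxHeartbeats 800000 in
-- abbrev towers over the datum
/-- **(a) on vectors — the Euler vector kills the cone form of a basic cochain**: for `H = g gᴴ` in the
positive cone (`g = sec H`), `ω_c(H)(H, v₁, …) = E(g) η(g⁻¹ · ½ H g⁻ᴴ, …)(g, c) = E(g) η(½ Z, …)(g, c) = 0`
since `g⁻¹ · ½ (g gᴴ) g⁻ᴴ = ½ · 1` and `i_Z η = 0`. [cite: BorelWallach2000, VII 2.2] -/
theorem coneForm_apply_vecCons_self {η : ConeDictionary.Cochain π lam (q + 1)}
    (hZ : ins q (⟨1, trivial⟩ : (AutomorphyDatum.gl n K hcpt).arch.lie) η = 0)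
    (c : BigHeckeGLn.FiniteAdelicGL n K) {H : ResGLnCone.hermSpace n K} (hH : H ∈ ResGLnCone.posCone n K)
    (v : Fin q → ResGLnCone.hermSpace n K) :
    coneForm π S lam η c H (Matrix.vecCons H v) = 0 := by
  obtain ⟨hgu, hgH⟩ := sec_spec (n := n) (K := K) (H := H)
    (exists_isUnit_mul_conjTranspose_eq_of_mem_posCone hH)
  rw [coneForm_apply, leftTrivForm_apply, leftForm_apply, leftFormAlg_apply]
  set w : Fin (q + 1) → (AutomorphyDatum.gl n K hcpt).arch.lie := fun i =>
    toLie n K hcpt (Ring.inverse (sec n K H) * halfRight n K (sec n K H) (Matrix.vecCons H v i)) with hw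
  -- the first slot is `½ Z`
  have hw0 : w 0 = (1 / 2 : ℝ) • (⟨1, trivial⟩ : (AutomorphyDatum.gl n K hcpt).arch.lie) := by
    rw [hw]
    dsimp only
    rw [Matrix.cons_val_zero, halfRight_apply, ← hgH, Matrix.mul_assoc, ← Matrix.conjTranspose_mul,
      Ring.inverse_mul_cancel _ hgu, Matrix.conjTranspose_one, Matrix.mul_one, mul_smul_comm,
      Ring.inverse_mul_cancel _ hgu, map_smul]
    rfl
  have key : η w = 0 := by
    have h1 : η w = ins q (w 0) η (Fin.tail w) := by
      rw [ins_apply]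
      exact congrArg η (Fin.cons_self_tail w).symm
    rw [h1, hw0, ins_smul, AlternatingMap.smul_apply, hZ, AlternatingMap.zero_apply, smul_zero]
  rw [key, map_zero]

set_option maxHeartbeats 800000 in
-- abbrev towers over the datum; two matrix computations and the assembly in one declaration
/-- **(b) on vectors — scale invariance of the cone form of a basic cocycle**: for `r > 0` and `H = g gᴴ`
in the positive cone, `ω_c(r H)(r v₁, …) = ω_c(H)(v₁, …)`: `√r g` is a square root of `r H` (independence
of the section, `ConeDictionary.coneForm_eq_of_mul_conjTranspose_eq`), the slots
`(√r g)⁻¹ · ½ (r vᵢ) (√r g)⁻ᴴ = g⁻¹ · ½ vᵢ g⁻ᴴ` of `η` are unchanged, and the point moves from `g` to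
`√r g` (`leftForm_smul_eq_of_basic`). [cite: BorelWallach2000, I §1.3 and VII 2.2] -/
theorem coneForm_smul_apply_smul {η : ConeDictionary.Cochain π lam (q + 1)}
    (hη : η ∈ (ConeDictionary.gkComplexLS π S lam).cocycles (q + 1))
    (hZ : ins q (⟨1, trivial⟩ : (AutomorphyDatum.gl n K hcpt).arch.lie) η = 0)
    (c : BigHeckeGLn.FiniteAdelicGL n K) {r : ℝ} (hr : 0 < r) {H : ResGLnCone.hermSpace n K}
    (hH : H ∈ ResGLnCone.posCone n K) (v : Fin (q + 1) → ResGLnCone.hermSpace n K) :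
    coneForm π S lam η c (r • H) (fun i => r • v i) = coneForm π S lam η c H v := by
  have hηc : η ∈ (gkComplexLS π S lam).carrier (q + 1) :=
    (((gkComplexLS π S lam).mem_cocycles_iff (q + 1) η).1 hη).1
  obtain ⟨g, hgu, hgH⟩ := exists_isUnit_mul_conjTranspose_eq_of_mem_posCone hH
  -- `s = √r`
  set s : ℝ := Real.sqrt r with hs_def
  have hs : 0 < s := Real.sqrt_pos.2 hr
  have hss : s * s = r := Real.mul_self_sqrt hr.le
  have hsgu : IsUnit (s • g) := by
    rw [Algebra.smul_def]
    exact ((isUnit_iff_ne_zero.2 hs.ne').map (algebraMap ℝ (Matrix (Fin n) (Fin n) (mixedSpace K)))).mul hgu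
  have hcoe : (((GLn.archOfMatrix n K g : (AutomorphyDatum.gl n K hcpt).arch.carrier) :
      GL (Fin n) (mixedSpace K)) : Matrix (Fin n) (Fin n) (mixedSpace K)) = g := GLn.coe_archOfMatrix hgu
  have hcoes : (((GLn.archOfMatrix n K (s • g) : (AutomorphyDatum.gl n K hcpt).arch.carrier) :
      GL (Fin n) (mixedSpace K)) : Matrix (Fin n) (Fin n) (mixedSpace K)) = s • g := GLn.coe_archOfMatrix hsgu
  -- `√r g` is a square root of `r H`
  have hsq : (s • g) * (s • g)ᴴ = ((r • H : ResGLnCone.hermSpace n K) : Matrix (Fin n) (Fin n) (mixedSpace K)) := by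
    rw [Submodule.coe_smul, Matrix.conjTranspose_smul, star_trivial, smul_mul_assoc, mul_smul_comm, smul_smul,
      hss, hgH]
  -- the inverse of `s • g`
  have hinv : Ring.inverse (s • g) = s⁻¹ • Ring.inverse g := by
    refine hsgu.mul_left_cancel ?_
    rw [Ring.mul_inverse_cancel _ hsgu, mul_smul_comm, smul_mul_assoc, smul_smul, Ring.mul_inverse_cancel _ hgu,
      inv_mul_cancel₀ hs.ne', one_smul]
  -- the slots of `η` are unchanged
  have harg : (fun i => Ring.inverse (s • g) * halfRight n K (s • g) (r • v i)) =
      fun i => Ring.inverse g * halfRight n K g (v i) := by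
    funext i
    rw [halfRight_apply, halfRight_apply, Submodule.coe_smul, hinv, Matrix.conjTranspose_smul, star_trivial]
    simp only [smul_mul_assoc, mul_smul_comm, smul_smul]
    congr 1
    rw [← hss]
    field_simp
  rw [coneForm_eq_of_mul_conjTranspose_eq π S lam hηc c (GLn.archOfMatrix n K (s • g)) (by rw [hcoes]; exact hsq),
    coneForm_eq_of_mul_conjTranspose_eq π S lam hηc c (GLn.archOfMatrix n K g) (by rw [hcoe]; exact hgH),
    hcoes, hcoe, ContinuousAlternatingMap.compContinuousLinearMap_apply,
    ContinuousAlternatingMap.compContinuousLinearMap_apply, Function.comp_def, Function.comp_def,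
    leftTrivForm_apply, leftTrivForm_apply, harg]
  exact leftForm_smul_eq_of_basic π S lam hη hZ c hgu hs _

/-! ### The registered stub -/

set_option maxHeartbeats 800000 in
-- abbrev towers over the datum
/-- **Stub BASIC — the cone form of a basic cocycle is a BASIC form on the cone**: killed by the
Euler vector field (`ω_c(H)(H, …) = E(g) η(g⁻¹ ½H g⁻ᴴ, …)(g, c) = ½ E(g) (i_Z η)(…)(g, c) = 0` by `hZ`) and
scale-invariant (`ω_c(rH) ∘ ∧(r·) = ω_c(H)`: a square root of `rH` is `√r · g`, the arguments of `η` are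
unchanged, and `s ↦ E(s g) · η(Y)(s g, c)` is constant because its derivative is the twisted
evaluation (c8 `stub_fderiv_twistedEval`) of the action of the central `Z = 1` on the VALUE `η(Y)`, which
vanishes: `θ_Z η = i_Z dη + d i_Z η = 0` (cocycle + `hZ`) and `θ_Z η (Y) = Z · η(Y)` as `Z` is central).
[cite: BorelWallach2000, I §1.3 and VII 2.2] -/
theorem stub_coneForm_basic {n : ℕ} {K : Type} [Field K] [NumberField K]
    {hcpt : isCompact_glFiniteIntegralLevel n K} (π : AutomorphicRepData (AutomorphyDatum.gl n K hcpt))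
    (S : Finset {w : InfinitePlace K // w.IsReal}) (lam : (K →+* ℂ) → Fin n → ℤ) {q : ℕ}
    {η : ConeDictionary.Cochain π lam (q + 1)}
    (hη : η ∈ (ConeDictionary.gkComplexLS π S lam).cocycles (q + 1))
    (hZ : Literature.Algebra.Lie.ChevalleyEilenberg.ins q
      (⟨1, trivial⟩ : (AutomorphyDatum.gl n K hcpt).arch.lie) η = 0)
    (c : BigHeckeGLn.FiniteAdelicGL n K) :
    (∀ H ∈ ResGLnCone.posCone n K, (ConeDictionary.coneForm π S lam η c H).curryLeft H = 0) ∧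
      ∀ (r : ℝ), 0 < r → ∀ H ∈ ResGLnCone.posCone n K,
        (ConeDictionary.coneForm π S lam η c (r • H)).compContinuousLinearMap
            (r • ContinuousLinearMap.id ℝ (ResGLnCone.hermSpace n K)) =
          ConeDictionary.coneForm π S lam η c H := by
  refine ⟨fun H hH => ?_, fun r hr H hH => ?_⟩
  · ext v
    rw [ContinuousAlternatingMap.curryLeft_apply_apply, ContinuousAlternatingMap.coe_zero, Pi.zero_apply]
    exact coneForm_apply_vecCons_self π S lam hZ c hH v
  · ext v
    rw [ContinuousAlternatingMap.compContinuousLinearMap_apply]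
    exact coneForm_smul_apply_smul π S lam hη hZ c hr hH v

end Summit.Langlands.Langlands.Theorems.HeckeEigenvalueField.Res

end
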